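import Literature.MathematicalPhysics.QuantumFieldTheory.Balaban1983to89.B13Term214WindowDilatedUnscaled

/-!
# `Balaban1983to89.B13Term214WindowDilatedConfig` — T. Bałaban, *Renormalization group approach to lattice gauge field
theories. II. Cluster expansions*, Commun. Math. Phys. **116** (1988) 1–22 [Balaban1988RG2Cluster], p. 15: THE TERM (2.14) —
in the window-dilated member currency of the unscaled-field law — IS HOLOMORPHIC IN ANY EXTERNAL PARAMETER ENTERING THE KERNELS
`A(σ)`, `Γ(σ)`, THE WILSON PART `W` AND THE OLDER TERMS `O` OF ITS LAST LINE, at a fixed member `b`: the CONFIGURATION direction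
(«analytic function of (𝐔, 𝐉)») from the primitive objects of the tree's (2.26) capstone, and its LOCAL-growth edition — no
new estimate

statement-level skeleton of published theorems with citation tags; proofs where landed; nothing here is a claim about the
Yang–Mills mass gap

PDF held: `paper:balaban1988-cmp116-rg-ii-cluster` (journal page = PDF page + 0), pp. 3, 11–12, 15–17; `paper:balaban1987-cmp109-rg-i`
pp. 263, 266–268.

CITATION HEADER (verbatim).  P. 15 [PDF 15], after (2.14): *"We consider it as an analytic function of (𝐔, 𝐉) in the space
𝐔^c_{k+1}(X, α₀, α₁), and of the complex parameters σ(Z), τ"*; p. 3 [PDF 3], (1.5) and the sentence before it: the basic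
operators of the step *"are analytic functions of 𝐔 on the space (1.4)"*; p. 11 [PDF 11], Lemma 2 and (1.41): the older terms
`E^{(j)}`, `j ≤ k`, enter the step through, and only through, the potentials `𝐕_k(Y, ·)`, linearly; [I] = [Balaban1987RG1] p. 263
ll. 22–26: the terms of the effective action are analytic functions on the spaces `𝐔^c_j(Y, α₀, α₁)` (the inductive assumption).
NOT PRINTED: a proof of the p. 15 sentence — it is holomorphy under the (2.14) integral signs, which print treats as evident; the
tree's model of `𝐔^c_{k+1}(X, α₀, α₁)` (`Node00.Sect2.spaceI`) is NOT open in the ambient configuration space `Φ`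
(`Summits/…/BalabanUVNodesN18HLayerW1SpaceNotOpen`), so the parameter set below is an arbitrary OPEN set of an arbitrary complex
normed space — print's «constants α′₀, α′₁ much bigger than α₀, α₁» thickening is the consumer's choice.

WHY (cell `pub-ymgap`, HUMAN RULING D-0062 Track A, node N22 [NE9] row s1, seat `pub-ymgap-dag-n22-c` g9; count-neutral).  Node
N22's located-input record at the (2.14) datum (`Summits/…/BalabanUVNodesN22W1RelCentredSliceInputsLG`, fields `hMan` ∕ `hVan`)
asks, per slice, that the window-dilated MEMBER `(2.14)_b[ψ]` and its coupling-blind CENTRE be ANALYTIC IN THE CONFIGURATION `ψ`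
at the point of the table — the analytic conjunct of the admissible-history class (`Node00.W1.AdmHist`) that the heredity of the
(1.18) bound needs at the next level.  Those two inputs are INTEGRAL-level statements.  THIS FILE reduces the member's to the
PRIMITIVE laws print states: the kernels `A_p(σ)`, `G_p(σ)` ((1.5) p. 3, NODE A), the Wilson part `W_p` and the older terms `O_p`
((1.41) p. 11 + [I] p. 263) complex differentiable in the parameter `p` of an open set `Wp`, with the (2.16)–(2.25) letters UNIFORM
on `Wp` — the configuration-direction twin of `B13Term214WindowDilated.differentiableOn_term214_torus_windowDilated_history_of_primitives`
(§5 there: the parameter in the older terms only) and of `B13Term214WindowDilatedUnscaled.differentiableOn_term214_torus_windowDilated_history_of_localGrowth_perBond`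
(§4 there), by the SAME two devices: `B13Term214ParamHolo.differentiableOn_term214_torus_param_of_primitives_holo_polyτ` (v1.1 §7:
kernels AND potentials parametrised) at the dilated kernels `b²A_p(σ)`, `bG_p(σ)` with `B13Term214WindowDilated` §2's letter
transports and `Re(b²A_p(σ)) ≻ 0` derived; then the clipped split pair of `B13Term214WindowDilatedUnscaled` §1 at each `p`.

WHAT IS HERE (no definition).
* §1 ★ `differentiableOn_term214_torus_windowDilated_config_of_primitives` — PRIMITIVES level: data and letters of
  `differentiableOn_term214_torus_windowDilated_history_of_primitives` with the kernels `A_p`, `Γ_p = G_p·`, the Wilson part `W_p`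
  and the older terms `O_p` ALL parametrised by `p ∈ Wp` (σ-holomorphy and the σ-letters at each `p`, `p`-holomorphy at each `σ`
  of the polydisc ∕ each `(Y, B)`; the joint (2.20) shape of `|W_p| + |O_p|` uniform in `p`); conclusion: at every member `b` of
  the ball, `p ↦ term214 r lZ lD (core214 (b²A_p) (bΓ_p) (F214 |P| χ χᶜ 𝐃 (b²W_p + O_p))) 0 0` is complex differentiable on `Wp`.
* §2 ★ `differentiableOn_term214_torus_windowDilated_config_of_localGrowth_perBond` — LOCAL-growth edition for the member
  family of the unscaled-field law `b²·s⁻²𝒲_p(Y, sB) + 𝒪_p(Y, sB)` ([I] (2.9)–(2.13)): the joint (2.20) letter replaced by the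
  per-domain τ-radii, the LOCAL letters (L0) (ℓ1) (L4) on the sup-ball `‖A‖ ≤ ρ`, bond supports, the PER-BOND multiplicity, the
  box-support law at the coupling and the `Y`-locality of the potentials, all UNIFORM in `p ∈ Wp`; proof: §1 on the CLIPPED
  split pair (`measurable_Wclip ∕ Oclip`, `h220U_clip_perBond_split` at each `p`), then `DifferentiableOn.congr` through
  `F214_clip_eq_member` at each `p`.
HONEST SCOPE.  Composition only; no estimate new in kind; generic finite-dimensional complex analysis over the block model of
record, every kernel family, letter and law a HYPOTHESIS; nothing of Bałaban's `Γ_k(Z₀,σ)`, `C^{(k)}(Z₀,σ)`, `χ`, `𝐕_k`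
constructed or asserted; nodes N10 ∕ N18 ∕ N22 ∕ N09 NOT discharged; one finite 𝕋⁴ programme at fixed ε — NOT continuum, NOT
infinite volume, NOT OS, NOT mass gap, NOT Clay.  No `sorry`, no definition, no new named fact (D-0026); standard axioms.
-/

noncomputable section

namespace Literature.MathematicalPhysics.QuantumFieldTheory.Balaban1983to89.B13Term214WindowDilatedConfig

open Matrix MeasureTheory Finset Complex Metric Set
open scoped Real
open B13Term214 (core214 F214 term214)
open B13Bound226Located (hR2_of_entrywise entry_bound_mono_rate)
open B13Lemma3TorusPrimitive (weightHyp_tdist1 tdist1_symm kc_tdist1)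
open B13Term214ParamHolo (differentiableOn_term214_torus_param_of_primitives_holo_polyτ)
open B13Term214WindowDilated (rad_nonneg_of_mem_ball sq_smul_sub_entry_le posDef_re_of_form theta_mul_lt_one h220_dilate
  smul_entry_le inv_sq_smul_entry_le smul_sub_entry_le inv_sq_smul_sub_entry_le)
open B13Term214WindowDilatedUnscaled (measurable_Wclip measurable_Oclip h220U_clip_perBond_split F214_clip_eq_member)
open B13ClippedFieldLetters (clip)
open TreeLengthTorus (TPt TDom tsys)
open B5TorusCover (UT)
open B9Thm37GlueTorus (tdist1)

variable {Λ : Type} [Fintype Λ] [DecidableEq Λ]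

/-! ## §1. The configuration direction at a fixed member `b`: holomorphy in an external parameter entering the kernels, the
Wilson part and the older terms, from the primitive letters -/

section Config

variable {d L N' : ℕ} [NeZero L] [NeZero N']
variable {ν : ℕ} {Nf : Fin ν → ℕ} [∀ i, NeZero (Nf i)]
variable {C₀ : Type} [Fintype C₀] [DecidableEq C₀]
variable {P : Type*} [NormedAddCommGroup P] [NormedSpace ℂ P] {Wp : Set P}

open Classical in
/-- **THE WINDOW-DILATED TERM AT A FIXED MEMBER `b` IS HOLOMORPHIC IN ANY EXTERNAL PARAMETER ENTERING THE KERNELS, THE WILSON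
PART AND THE OLDER TERMS** — the configuration direction of [II] p. 15 «analytic function of (𝐔, 𝐉)» at the primitives level:
the data of `B13Term214WindowDilated.differentiableOn_term214_torus_windowDilated_history_of_primitives` with the σ-families
`A_p(σ)` (precision), `Γ_p(σ)X = G_p(σ)·X` (cross operator, linear), the Wilson part `W_p` and the older terms `O_p` ALL moving
with the parameter `p` of an open set `Wp` of a complex normed space: entrywise σ-holomorphy of `A_p`, `G_p` and the (L17a)∕(L16a)
letters `K_G, K_{Cσ}, θ_Γ, θ_C, θ_E` on the open σ-polydisc AT EACH `p ∈ Wp` (one set of constants), entrywise `p`-holomorphy of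
`A_p(σ)`, `G_p(σ)` at each `σ` of the polydisc ((1.5) p. 3), `W_p(Y,·)`, `O_p(Y,·)` measurable at each `p` and `p ↦ W_p(Y, B)`,
`p ↦ O_p(Y, B)` complex differentiable on `Wp` ((1.41) p. 11, [I] p. 263), the joint (2.20) shape of `|W_p| + |O_p|` on the
per-domain τ-region uniform in `p`; the `p`-free characteristic functions with (2.22), references `C ≻ 0`, `Γ₀`, `K_E`, a radius
`ρ_b < 1`, primed letters dominating the transports, the capstone's numeric conditions in the primed letters.  NOT assumed:
`Re(b²A_p(σ)) ≻ 0` — derived (`posDef_re_of_form`).  Conclusion: for ONE member `b` of the ball, `p ↦ (2.14)_b` of the family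
`(b²A_p(σ), bΓ_p(σ), 𝐕 = b²W_p + O_p)` is complex differentiable on `Wp` — ONE application of
`B13Term214ParamHolo.differentiableOn_term214_torus_param_of_primitives_holo_polyτ` (v1.1 §7: kernels and potentials
parametrised) at the dilated kernels with the transported letters.
[cite: Balaban1988RG2Cluster, (2.14)–(2.15) p.15, (2.16)–(2.22) p.16, (2.23)–(2.25) p.17, (1.5) p.3, (1.41) p.11; Balaban1987RG1, §1 p.263, (2.10)-(2.12) p.267] -/
theorem differentiableOn_term214_torus_windowDilated_config_of_primitives (c : B13.Consts) (hWp : IsOpen Wp)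
    {Uσ : Set ℂ} {Uτ : TDom d (L * N') → Set ℂ} (hUσ : IsOpen Uσ) (hUτ : ∀ Y, IsOpen (Uτ Y))
    (hUexp : closedBall (0 : ℂ) (Real.exp c.κ₁) ⊆ Uσ)
    {r : ℝ} (hr : 0 < r) (hr' : r ≤ Real.exp c.κ₁ - 1)
    (hsubτ : ∀ Y, ∀ s ∈ Set.uIcc (0 : ℝ) 1, closedBall (s : ℂ) r ⊆ Uτ Y)
    {lZ : List (TPt d N')} (hlZ : lZ.Nodup) {lD : List (TDom d (L * N'))} (hlD : lD.Nodup)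
    (A : P → (TPt d N' → ℂ) → Matrix Λ Λ ℂ) (Γ : P → (TPt d N' → ℂ) → (Λ ⊕ C₀ → ℝ) → (Λ → ℂ))
    (cardP : ℕ) (χY₀ χcP : (Λ → ℝ) → ℝ) (hχ0 : ∀ B, 0 ≤ χY₀ B) (hχc0 : ∀ B, 0 ≤ χcP B)
    (Dfam : Finset (TDom d (L * N'))) (W O : P → TDom d (L * N') → (Λ → ℝ) → ℂ)
    {C : Matrix Λ Λ ℝ} (hC : C.PosDef) (Γ₀ : Matrix Λ (Λ ⊕ C₀) ℝ)
    -- the kernels in the parameter: σ-holomorphic at each p, p-holomorphic at each σ of the open polydisc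
    (hAhol : ∀ p ∈ Wp, ∀ i j, DifferentiableOn ℂ (fun σ => A p σ i j) {σ | ∀ j, σ j ∈ Uσ})
    (hAd : ∀ σ : TPt d N' → ℂ, (∀ j, σ j ∈ Uσ) → ∀ i j, DifferentiableOn ℂ (fun p => A p σ i j) Wp)
    (hχm : Measurable χY₀) (hχcm : Measurable χcP)
    -- the Wilson part and the older terms in the parameter: measurable in the field, holomorphic in `p`
    (hWm : ∀ p ∈ Wp, ∀ Y, Measurable (W p Y)) (hWd : ∀ Y B, DifferentiableOn ℂ (fun p => W p Y B) Wp)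
    (hOm : ∀ p ∈ Wp, ∀ Y, Measurable (O p Y)) (hOd : ∀ Y B, DifferentiableOn ℂ (fun p => O p Y B) Wp)
    (hAs : ∀ p ∈ Wp, ∀ σ : TPt d N' → ℂ, (∀ j, σ j ∈ Uσ) → (A p σ).IsSymm)
    (G : P → (TPt d N' → ℂ) → Matrix Λ (Λ ⊕ C₀) ℂ)
    (hGhol : ∀ p ∈ Wp, ∀ i j, DifferentiableOn ℂ (fun σ => G p σ i j) {σ | ∀ j, σ j ∈ Uσ})
    (hGd : ∀ σ : TPt d N' → ℂ, (∀ j, σ j ∈ Uσ) → ∀ i j, DifferentiableOn ℂ (fun p => G p σ i j) Wp)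
    (hlin : ∀ p ∈ Wp, ∀ σ : TPt d N' → ℂ, (∀ j, σ j ∈ Uσ) → ∀ X : Λ ⊕ C₀ → ℝ, Γ p σ X = G p σ *ᵥ fun j => (X j : ℂ))
    {γ₂ rP a₂₀ w : ℝ} (qP : (Λ → ℝ) → ℝ)
    (h222 : ∀ B, χY₀ B * χcP B ≤ Real.exp (-(γ₂ / 2 * rP ^ 2 * cardP) + γ₂ / 2 * qP B)) (hγ₂ : 0 ≤ γ₂)
    (hqP : ∀ B, qP B ≤ B ⬝ᵥ B) (ha0 : 0 ≤ a₂₀)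
    (h220U : ∀ p ∈ Wp, ∀ τ : TDom d (L * N') → ℂ, (∀ Y, τ Y ∈ Uτ Y) →
      ∀ B, ∑ Y ∈ Dfam, ‖τ Y‖ * (‖W p Y B‖ + ‖O p Y B‖) ≤ a₂₀ / 2 * (B ⬝ᵥ B) + w)
    (locΛ : Λ → UT Nf) (locN : Λ ⊕ C₀ → UT Nf) {m : ℕ}
    (hfibΛ : ∀ x : UT Nf, (Finset.univ.filter fun i => locΛ i = x).card ≤ m)
    (hfibN : ∀ x : UT Nf, (Finset.univ.filter fun j => locN j = x).card ≤ m)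
    {kap kap' kap'' θ θE θΓ θC KG KΓ KCs K₀ KE : ℝ} (hkap'' : 0 < kap'') (h1 : kap'' < kap') (h2 : kap' < kap)
    (hθE : 0 ≤ θE) (hθΓ : 0 ≤ θΓ) (hθC : 0 ≤ θC) (hKG : 0 ≤ KG) (hKΓ : 0 ≤ KΓ) (hKCs : 0 ≤ KCs) (hK₀ : 0 ≤ K₀)
    (hKE : 0 ≤ KE)
    (hG : ∀ p ∈ Wp, ∀ σ : TPt d N' → ℂ, (∀ j, σ j ∈ Uσ) →
      ∀ b j, ‖G p σ b j‖ ≤ KG * Real.exp (-(kap * tdist1 Nf (locΛ b) (locN j))))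
    (hΓ₀ : ∀ b j, ‖Γ₀ b j‖ ≤ KΓ * Real.exp (-(kap * tdist1 Nf (locΛ b) (locN j))))
    (hCs : ∀ p ∈ Wp, ∀ σ : TPt d N' → ℂ, (∀ j, σ j ∈ Uσ) →
      ∀ b b', ‖(A p σ)⁻¹ b b'‖ ≤ KCs * Real.exp (-(kap * tdist1 Nf (locΛ b) (locΛ b'))))
    (hC216 : ∀ b b', ‖C b b'‖ ≤ K₀ * Real.exp (-(kap * tdist1 Nf (locΛ b) (locΛ b'))))
    (hCE : ∀ b b', ‖(C⁻¹.map (algebraMap ℝ ℂ)) b b'‖ ≤ KE * Real.exp (-(kap * tdist1 Nf (locΛ b) (locΛ b'))))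
    (hdΓ : ∀ p ∈ Wp, ∀ σ : TPt d N' → ℂ, (∀ j, σ j ∈ Uσ) →
      ∀ b j, ‖(G p σ - Γ₀.map (algebraMap ℝ ℂ)) b j‖ ≤ θΓ * Real.exp (-(kap * tdist1 Nf (locΛ b) (locN j))))
    (hdC : ∀ p ∈ Wp, ∀ σ : TPt d N' → ℂ, (∀ j, σ j ∈ Uσ) →
      ∀ b b', ‖((A p σ)⁻¹ - C.map (algebraMap ℝ ℂ)) b b'‖
        ≤ θC * Real.exp (-(kap * tdist1 Nf (locΛ b) (locΛ b'))))
    (hdE : ∀ p ∈ Wp, ∀ σ : TPt d N' → ℂ, (∀ j, σ j ∈ Uσ) →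
      ∀ b b', ‖(A p σ - C⁻¹.map (algebraMap ℝ ℂ)) b b'‖ ≤ θE * Real.exp (-(kap * tdist1 Nf (locΛ b) (locΛ b'))))
    {ρb KG' KCs' θΓ' θC' θE' a' w' : ℝ} (hρb1 : ρb < 1)
    (hKG' : (1 + ρb) * KG ≤ KG') (hKCs' : ((1 - ρb) ^ 2)⁻¹ * KCs ≤ KCs')
    (hθΓ' : θΓ + ρb * KG ≤ θΓ') (hθC' : θC + ρb * (2 + ρb) * ((1 - ρb) ^ 2)⁻¹ * KCs ≤ θC')
    (hθE' : θE + ρb * (2 + ρb) * (θE + KE) ≤ θE')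
    (ha' : (1 + ρb) ^ 2 * a₂₀ ≤ a') (hw' : (1 + ρb) ^ 2 * w ≤ w')
    (hθEle : θE' ≤ θ) (hθΓle : θΓ' ≤ θ)
    (hθR1le : (m * (1 + 2 / (kap - kap')) ^ ν) * (m * (1 + 2 / (kap' - kap'')) ^ ν)
      * (θΓ' * KCs' * KG' + KΓ * θC' * KG' + KΓ * K₀ * θΓ') ≤ θ)
    (hsmallKθ : K₀ * (m * (1 + 2 / kap) ^ ν) * (θ * (m * (1 + 2 / kap'') ^ ν)) < 1)
    {cE g : ℝ} (hc0 : 0 ≤ cE) (hc : ∀ k, hC.1.eigenvalues k ≤ cE)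
    (hαc : (2 * (θ * (m * (1 + 2 / kap'') ^ ν)) + (γ₂ + a')) * cE ≤ 1 / 2)
    (hΓq : ∀ X : Λ ⊕ C₀ → ℝ, (Γ₀ *ᵥ X) ⬝ᵥ (C *ᵥ (Γ₀ *ᵥ X)) ≤ g * (X ⬝ᵥ X))
    (hsmall : (2 * (θ * (m * (1 + 2 / kap'') ^ ν)) + (γ₂ + a')) * (1 + 2 * cE * g) ≤ 1 / 2)
    {b : ℂ} (hb : b ∈ ball (1 : ℂ) ρb) :
    DifferentiableOn ℂ (fun p : P => term214 r lZ lD (core214 (fun σ => b ^ 2 • A p σ) (fun σ X => b • Γ p σ X)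
      (F214 cardP χY₀ χcP Dfam (fun Y B => b ^ 2 * W p Y B + O p Y B))) 0 0) Wp := by
  have hρb0 : 0 ≤ ρb := rad_nonneg_of_mem_ball hb
  have hexp : ∀ x : ℝ, 0 ≤ Real.exp x := fun x => (Real.exp_pos x).le
  have hθ : 0 ≤ θ := le_trans (le_trans (by positivity) hθE') hθEle
  have hkk : kap'' ≤ kap := (h1.trans h2).le
  have ha0' : 0 ≤ a' := le_trans (by positivity) ha'
  -- the transported E-letter and the derived positivity at this `b`, at each parameter
  have hdE' : ∀ p ∈ Wp, ∀ σ : TPt d N' → ℂ, (∀ j, σ j ∈ Uσ) →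
      ∀ i j, ‖(b ^ 2 • A p σ - C⁻¹.map (algebraMap ℝ ℂ)) i j‖
        ≤ θE' * Real.exp (-(kap * tdist1 Nf (locΛ i) (locΛ j))) := fun p hp σ hσ i j =>
    (sq_smul_sub_entry_le hCE (hdE p hp σ hσ) hb i j).trans (mul_le_mul_of_nonneg_right hθE' (hexp _))
  have hA' : ∀ p ∈ Wp, ∀ σ : TPt d N' → ℂ, (∀ j, σ j ∈ Uσ) → ((b ^ 2 • A p σ).map Complex.re).PosDef := by
    intro p hp σ hσ
    have h216E : ∀ i j, ‖(b ^ 2 • A p σ - C⁻¹.map (algebraMap ℝ ℂ)) i j‖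
        ≤ θ * Real.exp (-(kap'' * tdist1 Nf (locΛ i) (locΛ j))) := fun i j =>
      (entry_bound_mono_rate (weightHyp_tdist1 (N := Nf)) (le_trans (by positivity) hθE') hkk locΛ locΛ (hdE' p hp σ hσ)
        i j).trans (mul_le_mul_of_nonneg_right hθEle (hexp _))
    refine posDef_re_of_form ((hAs p hp σ hσ).smul _) hC hc
      (hR2_of_entrywise (weightHyp_tdist1 (N := Nf)) tdist1_symm kc_tdist1 hθ hkap'' locΛ hfibΛ h216E) ?_
    exact theta_mul_lt_one hγ₂ ha0' hc0 hαc
  -- ONE application of module 36 §7 (kernels AND potentials parametrised) at the dilated kernels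
  exact differentiableOn_term214_torus_param_of_primitives_holo_polyτ c hWp hUσ hUτ hUexp hr hr' hsubτ hlZ hlD
    (fun p σ => b ^ 2 • A p σ) (fun p σ X => b • Γ p σ X) cardP χY₀ χcP hχ0 hχc0 Dfam
    (fun p Y B => b ^ 2 * W p Y B + O p Y B) hC Γ₀
    (fun p hp i j => by
      simpa only [Matrix.smul_apply, smul_eq_mul] using (hAhol p hp i j).const_mul (b ^ 2))
    (fun σ hσ i j => by
      simpa only [Matrix.smul_apply, smul_eq_mul] using (hAd σ hσ i j).const_mul (b ^ 2))
    hχm hχcm (fun p hp Y => ((hWm p hp Y).const_mul _).add (hOm p hp Y))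
    (fun Y B => ((hWd Y B).const_mul _).add (hOd Y B))
    (fun p hp σ hσ => (hAs p hp σ hσ).smul _) hA' (fun p σ => b • G p σ)
    (fun p hp i j => by
      simpa only [Matrix.smul_apply, smul_eq_mul] using (hGhol p hp i j).const_mul b)
    (fun σ hσ i j => by
      simpa only [Matrix.smul_apply, smul_eq_mul] using (hGd σ hσ i j).const_mul b)
    (fun p hp σ hσ X => by rw [hlin p hp σ hσ X, Matrix.smul_mulVec]) qP h222 hγ₂ hqP ha0'
    (fun p hp τ hτ B => (h220_dilate Dfam τ (h220U p hp τ hτ) hb B).trans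
      (add_le_add (mul_le_mul_of_nonneg_right (by linarith)
        (Finset.sum_nonneg fun i _ => mul_self_nonneg (B i))) hw'))
    locΛ locN hfibΛ hfibN hkap'' h1 h2 (le_trans (by positivity) hθE') (le_trans (by positivity) hθΓ')
    (le_trans (by positivity) hθC') (le_trans (by positivity) hKG') hKΓ (le_trans (by positivity) hKCs') hK₀ hθEle hθΓle
    hθR1le
    (fun p hp σ hσ i j => (smul_entry_le (hG p hp σ hσ) hb i j).trans (mul_le_mul_of_nonneg_right hKG' (hexp _))) hΓ₀
    (fun p hp σ hσ i j => (inv_sq_smul_entry_le (hCs p hp σ hσ) hρb1 hb i j).trans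
      (mul_le_mul_of_nonneg_right hKCs' (hexp _)))
    hC216
    (fun p hp σ hσ i j => (smul_sub_entry_le (hG p hp σ hσ) (hdΓ p hp σ hσ) hb i j).trans
      (mul_le_mul_of_nonneg_right hθΓ' (hexp _)))
    (fun p hp σ hσ i j => (inv_sq_smul_sub_entry_le (hCs p hp σ hσ) (hdC p hp σ hσ) hρb1 hb i j).trans
      (mul_le_mul_of_nonneg_right hθC' (hexp _)))
    hdE' hsmallKθ hc0 hc hαc hΓq hsmall

end Config

/-! ## §2. The configuration direction for the member family of the unscaled-field law, from LOCAL growth letters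
(per-bond rate) uniform in the parameter -/

section ConfigLocal

variable {d L N' : ℕ} [NeZero L] [NeZero N'] {M : ℕ}
variable {ν : ℕ} {Nf : Fin ν → ℕ} [∀ i, NeZero (Nf i)]
variable {C₀ : Type} [Fintype C₀] [DecidableEq C₀]
variable {P : Type*} [NormedAddCommGroup P] [NormedSpace ℂ P] {Wp : Set P}

open Classical in
/-- **THE CONFIGURATION DIRECTION FOR THE MEMBER FAMILY OF THE UNSCALED-FIELD LAW, FROM LOCAL GROWTH LETTERS UNIFORM IN THE
PARAMETER** ([II] p. 15 «analytic function of (𝐔, 𝐉)» for the window-dilated member `b²·s⁻²𝒲_p(Y, sB) + 𝒪_p(Y, sB)` of [I]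
(2.9)–(2.13) at a real base point `s > 0` and a fixed member `b` of the ball): the data and letters of
`B13Term214WindowDilatedUnscaled.differentiableOn_term214_torus_windowDilated_history_of_localGrowth_perBond` with the kernels
`A_p(σ)`, `G_p(σ)` (σ-holomorphy + the σ-letters at each `p`, `p`-holomorphy at each `σ`) and BOTH coupling-free potentials
`𝒲_p`, `𝒪_p` (measurable in the field at each `p`; `p ↦ 𝒲_p(Y, A)`, `p ↦ 𝒪_p(Y, A)` complex differentiable on `Wp`) moving with
the parameter `p` of an open set `Wp` of a complex normed space; in place of the joint (2.20) letter: per-domain τ-radii `R(Y)`,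
the LOCAL letters (L0) `‖𝒪_p(Y,0)‖ ≤ c₀(Y)`, (ℓ1) `‖𝒲_p(Y,A)‖ ≤ c₃(Y)‖A‖Σ_{b∈S Y}A_b²`, (L4) `‖𝒪_p(Y,A) − 𝒪_p(Y,0)‖ ≤ c₁(Y)‖A‖`
on the sup-ball `‖A‖ ≤ ρ`, bond supports `S Y`, the PER-BOND multiplicity `m₃`, the box-support law at the coupling and the
`Y`-locality of both potentials in `S₀` — all UNIFORM in `p ∈ Wp`; primed letters `a′ ≥ (1+ρ_b)²·2ρm₃`,
`w′ ≥ (1+ρ_b)²·Σ_Y R(Y)(c₀(Y) + c₁(Y)ρ)`.  Conclusion: `p ↦ term214(b²A_p, bΓ_p, F214 χ χᶜ (b²·s⁻²𝒲_p(s·) + 𝒪_p(s·)))` is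
complex differentiable on `Wp`.  Proof: §1 on the CLIPPED split pair (`p ↦ 𝒲_p(Y, clip ρ(sB))`, `p ↦ 𝒪_p(Y, clip ρ(sB))` are
complex differentiable with `𝒲_p(Y,·)`, `𝒪_p(Y,·)`; `h220U_clip_perBond_split` at each `p`), then `DifferentiableOn.congr`
through `F214_clip_eq_member` at each `p ∈ Wp`.  No new engine, no estimate new in kind.
[cite: Balaban1988RG2Cluster, (2.14)–(2.15) p.15, (2.16)–(2.22) p.16, (2.23)–(2.25) p.17, (1.5) p.3, (1.41)–(1.42) p.11, (2.2)–(2.3) p.12, (1.20) p.6; Balaban1987RG1, §1 p.263, (2.9)–(2.13) pp.266–268] -/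
theorem differentiableOn_term214_torus_windowDilated_config_of_localGrowth_perBond (c : B13.Consts)
    (hWp : IsOpen Wp)
    {Uσ : Set ℂ} {Uτ : TDom d (L * N') → Set ℂ} (hUσ : IsOpen Uσ) (hUτ : ∀ Y, IsOpen (Uτ Y))
    (hUexp : closedBall (0 : ℂ) (Real.exp c.κ₁) ⊆ Uσ)
    {r : ℝ} (hr : 0 < r) (hr' : r ≤ Real.exp c.κ₁ - 1)
    (hsubτ : ∀ Y, ∀ s ∈ Set.uIcc (0 : ℝ) 1, closedBall (s : ℂ) r ⊆ Uτ Y)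
    {lZ : List (TPt d N')} (hlZ : lZ.Nodup) {lD : List (TDom d (L * N'))} (hlD : lD.Nodup)
    (A : P → (TPt d N' → ℂ) → Matrix Λ Λ ℂ) (Γ : P → (TPt d N' → ℂ) → (Λ ⊕ C₀ → ℝ) → (Λ → ℂ))
    (cardP : ℕ) (χY₀ χcP : (Λ → ℝ) → ℝ) (hχ0 : ∀ B, 0 ≤ χY₀ B) (hχc0 : ∀ B, 0 ≤ χcP B)
    (Dfam : Finset (TDom d (L * N')))
    -- the last line: the coupling-free Wilson part `𝒲_p` and older terms `𝒪_p` parametrised by `p ∈ Wp`, at the coupling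
    -- `s`, clipping radius `ρ`
    (𝒲 𝒪 : P → TDom d (L * N') → (Λ → ℝ) → ℂ) {ρ s : ℝ} (hs : 0 < s) (hρ : 0 ≤ ρ)
    {C : Matrix Λ Λ ℝ} (hC : C.PosDef) (Γ₀ : Matrix Λ (Λ ⊕ C₀) ℝ)
    (hAhol : ∀ p ∈ Wp, ∀ i j, DifferentiableOn ℂ (fun σ => A p σ i j) {σ | ∀ j, σ j ∈ Uσ})
    (hAd : ∀ σ : TPt d N' → ℂ, (∀ j, σ j ∈ Uσ) → ∀ i j, DifferentiableOn ℂ (fun p => A p σ i j) Wp)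
    (hχm : Measurable χY₀) (hχcm : Measurable χcP)
    (h𝒲m : ∀ p ∈ Wp, ∀ Y, Measurable (𝒲 p Y)) (h𝒲d : ∀ Y A, DifferentiableOn ℂ (fun p => 𝒲 p Y A) Wp)
    (h𝒪m : ∀ p ∈ Wp, ∀ Y, Measurable (𝒪 p Y)) (h𝒪d : ∀ Y A, DifferentiableOn ℂ (fun p => 𝒪 p Y A) Wp)
    (hAs : ∀ p ∈ Wp, ∀ σ : TPt d N' → ℂ, (∀ j, σ j ∈ Uσ) → (A p σ).IsSymm)
    (G : P → (TPt d N' → ℂ) → Matrix Λ (Λ ⊕ C₀) ℂ)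
    (hGhol : ∀ p ∈ Wp, ∀ i j, DifferentiableOn ℂ (fun σ => G p σ i j) {σ | ∀ j, σ j ∈ Uσ})
    (hGd : ∀ σ : TPt d N' → ℂ, (∀ j, σ j ∈ Uσ) → ∀ i j, DifferentiableOn ℂ (fun p => G p σ i j) Wp)
    (hlin : ∀ p ∈ Wp, ∀ σ : TPt d N' → ℂ, (∀ j, σ j ∈ Uσ) → ∀ X : Λ ⊕ C₀ → ℝ, Γ p σ X = G p σ *ᵥ fun j => (X j : ℂ))
    {γ₂ rP : ℝ} (qP : (Λ → ℝ) → ℝ)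
    (h222 : ∀ B, χY₀ B * χcP B ≤ Real.exp (-(γ₂ / 2 * rP ^ 2 * cardP) + γ₂ / 2 * qP B)) (hγ₂ : 0 ≤ γ₂)
    (hqP : ∀ B, qP B ≤ B ⬝ᵥ B)
    -- in place of the joint (2.20) letter uniform in `p`: per-domain τ-radii `R(Y)`, the LOCAL letters (L0), (L4) for `𝒪_p`
    -- and (ℓ1) for `𝒲_p` on the sup-ball of radius `ρ`, uniformly in `p ∈ Wp`, bond supports `S Y`, the PER-BOND multiplicity
    -- `m₃`, the box-support law at the coupling and the `Y`-locality of the potentials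
    {R c₀ c₁ c₃ : TDom d (L * N') → ℝ} (hR : ∀ Y ∈ Dfam, 0 ≤ R Y) (hc₃ : ∀ Y ∈ Dfam, 0 ≤ c₃ Y) (hc₁ : ∀ Y ∈ Dfam, 0 ≤ c₁ Y)
    (hUτR : ∀ Y ∈ Dfam, ∀ z ∈ Uτ Y, ‖z‖ ≤ R Y) (h0 : ∀ p ∈ Wp, ∀ Y ∈ Dfam, ‖𝒪 p Y 0‖ ≤ c₀ Y)
    (S : TDom d (L * N') → Finset Λ)
    (h1loc : ∀ p ∈ Wp, ∀ Y ∈ Dfam, ∀ A, ‖A‖ ≤ ρ → ‖𝒲 p Y A‖ ≤ c₃ Y * ‖A‖ * ∑ b ∈ S Y, A b ^ 2)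
    (h4 : ∀ p ∈ Wp, ∀ Y ∈ Dfam, ∀ A, ‖A‖ ≤ ρ → ‖𝒪 p Y A - 𝒪 p Y 0‖ ≤ c₁ Y * ‖A‖)
    {m₃ : ℝ} (hm₃0 : 0 ≤ m₃) (hm₃ : ∀ bd, ∑ Y ∈ Dfam with bd ∈ S Y, R Y * c₃ Y ≤ m₃)
    (S₀ : Set Λ) (hbox : ∀ B, χY₀ B ≠ 0 → ∀ b ∈ S₀, |(s • B) b| ≤ ρ)
    (hloc𝒲 : ∀ p ∈ Wp, ∀ Y ∈ Dfam, ∀ A A' : Λ → ℝ, (∀ b ∈ S₀, A b = A' b) → 𝒲 p Y A = 𝒲 p Y A')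
    (hloc𝒪 : ∀ p ∈ Wp, ∀ Y ∈ Dfam, ∀ A A' : Λ → ℝ, (∀ b ∈ S₀, A b = A' b) → 𝒪 p Y A = 𝒪 p Y A')
    (locΛ : Λ → UT Nf) (locN : Λ ⊕ C₀ → UT Nf) {m : ℕ}
    (hfibΛ : ∀ x : UT Nf, (Finset.univ.filter fun i => locΛ i = x).card ≤ m)
    (hfibN : ∀ x : UT Nf, (Finset.univ.filter fun j => locN j = x).card ≤ m)
    {kap kap' kap'' θ θE θΓ θC KG KΓ KCs K₀ KE : ℝ} (hkap'' : 0 < kap'') (h1 : kap'' < kap') (h2 : kap' < kap)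
    (hθE : 0 ≤ θE) (hθΓ : 0 ≤ θΓ) (hθC : 0 ≤ θC) (hKG : 0 ≤ KG) (hKΓ : 0 ≤ KΓ) (hKCs : 0 ≤ KCs) (hK₀ : 0 ≤ K₀)
    (hKE : 0 ≤ KE)
    (hG : ∀ p ∈ Wp, ∀ σ : TPt d N' → ℂ, (∀ j, σ j ∈ Uσ) →
      ∀ b j, ‖G p σ b j‖ ≤ KG * Real.exp (-(kap * tdist1 Nf (locΛ b) (locN j))))
    (hΓ₀ : ∀ b j, ‖Γ₀ b j‖ ≤ KΓ * Real.exp (-(kap * tdist1 Nf (locΛ b) (locN j))))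
    (hCs : ∀ p ∈ Wp, ∀ σ : TPt d N' → ℂ, (∀ j, σ j ∈ Uσ) →
      ∀ b b', ‖(A p σ)⁻¹ b b'‖ ≤ KCs * Real.exp (-(kap * tdist1 Nf (locΛ b) (locΛ b'))))
    (hC216 : ∀ b b', ‖C b b'‖ ≤ K₀ * Real.exp (-(kap * tdist1 Nf (locΛ b) (locΛ b'))))
    (hCE : ∀ b b', ‖(C⁻¹.map (algebraMap ℝ ℂ)) b b'‖ ≤ KE * Real.exp (-(kap * tdist1 Nf (locΛ b) (locΛ b'))))
    (hdΓ : ∀ p ∈ Wp, ∀ σ : TPt d N' → ℂ, (∀ j, σ j ∈ Uσ) →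
      ∀ b j, ‖(G p σ - Γ₀.map (algebraMap ℝ ℂ)) b j‖ ≤ θΓ * Real.exp (-(kap * tdist1 Nf (locΛ b) (locN j))))
    (hdC : ∀ p ∈ Wp, ∀ σ : TPt d N' → ℂ, (∀ j, σ j ∈ Uσ) →
      ∀ b b', ‖((A p σ)⁻¹ - C.map (algebraMap ℝ ℂ)) b b'‖
        ≤ θC * Real.exp (-(kap * tdist1 Nf (locΛ b) (locΛ b'))))
    (hdE : ∀ p ∈ Wp, ∀ σ : TPt d N' → ℂ, (∀ j, σ j ∈ Uσ) →
      ∀ b b', ‖(A p σ - C⁻¹.map (algebraMap ℝ ℂ)) b b'‖ ≤ θE * Real.exp (-(kap * tdist1 Nf (locΛ b) (locΛ b'))))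
    {ρb KG' KCs' θΓ' θC' θE' a' w' : ℝ} (hρb1 : ρb < 1)
    (hKG' : (1 + ρb) * KG ≤ KG') (hKCs' : ((1 - ρb) ^ 2)⁻¹ * KCs ≤ KCs')
    (hθΓ' : θΓ + ρb * KG ≤ θΓ') (hθC' : θC + ρb * (2 + ρb) * ((1 - ρb) ^ 2)⁻¹ * KCs ≤ θC')
    (hθE' : θE + ρb * (2 + ρb) * (θE + KE) ≤ θE')
    (ha' : (1 + ρb) ^ 2 * (2 * ρ * m₃) ≤ a') (hw' : (1 + ρb) ^ 2 * (∑ Y ∈ Dfam, R Y * (c₀ Y + c₁ Y * ρ)) ≤ w')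
    (hθEle : θE' ≤ θ) (hθΓle : θΓ' ≤ θ)
    (hθR1le : (m * (1 + 2 / (kap - kap')) ^ ν) * (m * (1 + 2 / (kap' - kap'')) ^ ν)
      * (θΓ' * KCs' * KG' + KΓ * θC' * KG' + KΓ * K₀ * θΓ') ≤ θ)
    (hsmallKθ : K₀ * (m * (1 + 2 / kap) ^ ν) * (θ * (m * (1 + 2 / kap'') ^ ν)) < 1)
    {cE g : ℝ} (hc0 : 0 ≤ cE) (hc : ∀ k, hC.1.eigenvalues k ≤ cE)
    (hαc : (2 * (θ * (m * (1 + 2 / kap'') ^ ν)) + (γ₂ + a')) * cE ≤ 1 / 2)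
    (hΓq : ∀ X : Λ ⊕ C₀ → ℝ, (Γ₀ *ᵥ X) ⬝ᵥ (C *ᵥ (Γ₀ *ᵥ X)) ≤ g * (X ⬝ᵥ X))
    (hsmall : (2 * (θ * (m * (1 + 2 / kap'') ^ ν)) + (γ₂ + a')) * (1 + 2 * cE * g) ≤ 1 / 2)
    {b : ℂ} (hb : b ∈ ball (1 : ℂ) ρb) :
    DifferentiableOn ℂ (fun p : P => term214 r lZ lD (core214 (fun σ => b ^ 2 • A p σ) (fun σ X => b • Γ p σ X)
      (F214 cardP χY₀ χcP Dfam
        (fun Y B => b ^ 2 * ((((s : ℝ) : ℂ) ^ 2)⁻¹ * 𝒲 p Y (s • B)) + 𝒪 p Y (s • B)))) 0 0) Wp := by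
  have ha0 : 0 ≤ 2 * ρ * m₃ := by positivity
  have h := differentiableOn_term214_torus_windowDilated_config_of_primitives c hWp hUσ hUτ hUexp hr hr' hsubτ hlZ hlD A Γ
    cardP χY₀ χcP hχ0 hχc0 Dfam (fun p Y B => (((s : ℝ) : ℂ) ^ 2)⁻¹ * 𝒲 p Y (clip ρ (s • B)))
    (fun p Y B => 𝒪 p Y (clip ρ (s • B))) hC Γ₀ hAhol hAd hχm hχcm (fun p hp => measurable_Wclip ρ s (h𝒲m p hp))
    (fun Y B => (h𝒲d Y (clip ρ (s • B))).const_mul _)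
    (fun p hp => measurable_Oclip ρ s (h𝒪m p hp)) (fun Y B => h𝒪d Y (clip ρ (s • B))) hAs G hGhol hGd hlin qP h222 hγ₂ hqP
    ha0 (fun p hp => h220U_clip_perBond_split Dfam Uτ S hs hρ hR hc₃ hc₁ hUτR (h0 p hp) (h1loc p hp) (h4 p hp) hm₃)
    locΛ locN hfibΛ hfibN hkap'' h1 h2 hθE hθΓ hθC hKG hKΓ hKCs hK₀ hKE hG hΓ₀ hCs hC216 hCE hdΓ hdC hdE hρb1 hKG' hKCs'
    hθΓ' hθC' hθE' ha' hw' hθEle hθΓle hθR1le hsmallKθ hc0 hc hαc hΓq hsmall hb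
  refine h.congr fun p hp => ?_
  rw [F214_clip_eq_member cardP χY₀ χcP Dfam S₀ hbox (hloc𝒲 p hp) (hloc𝒪 p hp) b]

end ConfigLocal

end Literature.MathematicalPhysics.QuantumFieldTheory.Balaban1983to89.B13Term214WindowDilatedConfig

end
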